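import Summits.QuantumFields.YangMills.Theses.TwistExponentGap
import Mathlib
import HarnessLib

/-!
# Route `TwistExponentGap` (planner `ym-idea-4` g13, LINE g13-A; DRAFT by design): the aside ⟨stmt-QuantumFields-24056⟩
# `PrimitiveCommutatorRigid` — a clock–shift pair in `SU(N)` has finite centraliser

**Theorem** (`primitiveCommutatorRigid_proof`).  Let `N ≥ 2` and `x, y ∈ SU(N)` with group commutator `x y x⁻¹ y⁻¹ = ω·1`, `ω` a
PRIMITIVE `N`-th root of unity.  Then `{k ∈ SU(N) : kx = xk, ky = yk}` is finite (it is contained in `μ_N · 1`).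

Proof ('t Hooft's twist-eating argument, linear algebra only): `xy = ω yx`.  Take an eigenvector `v` of `y` (`ℂ` algebraically
closed), `y v = μ₀ v`, `μ₀ ≠ 0`; the chain `v_n = xⁿ v` satisfies `y v_n = ω^{−n} μ₀ v_n` (`mulVec_chain`), the `N` eigenvalues
`ω^{−n} μ₀`, `n < N`, are distinct (`ω⁻¹` is primitive), so `v_0, …, v_{N−1}` is a basis of `ℂ^N` (eigenvectors for distinct
eigenvalues are independent).  A matrix `k` commuting with `y` is diagonal in this basis (coordinates: `(μ_j − μ_i)·c_j = 0`), and
commuting with `x` makes the diagonal constant along the chain; so `k = κ·1` (`exists_eq_smul_one_of_comm`), and `det k = 1` gives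
`κ^N = 1`.  The centraliser therefore injects (by the `(0,0)` entry) into the `N`-th roots of unity, a finite set.

Mathlib only (+ the route file for the statement BY NAME); no `sorry`; no new definitions; standard axioms.  HONEST LABEL: a banked
linear-algebra ASIDE of a DRAFT route (it shows the rigid class of `RigidTwistCeiling` is non-empty and contains every `SU(N)`); no
crux (24053/24054/24055), no rung (R1 `MarginalTwistOnset`), no summit; the Yang–Mills mass gap is NOT proved.  Width seat
`ym-line-sfw-p2-w3` g34 (cell ym-idea-1, free hands). [cite: Thooft1979]
-/

set_option autoImplicit false

namespace Summit.QuantumFields.YangMills.Theorems.TwistExponentGap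

open Matrix Module
open scoped BigOperators

/-- Along the chain `v_n = Xⁿ v` of an eigenvector `Y v = μ₀ v`, the relation `X Y = ω • Y X` (with `ω ≠ 0`) propagates the
eigenvalue: `Y (Xⁿ v) = (ω⁻¹)ⁿ μ₀ · Xⁿ v`. [cite: Thooft1979] -/
theorem mulVec_chain {N : ℕ} {X Y : Matrix (Fin N) (Fin N) ℂ} {ω : ℂ} (hω0 : ω ≠ 0)
    (hXY : X * Y = ω • (Y * X)) {v : Fin N → ℂ} {μ₀ : ℂ} (hYv : Y *ᵥ v = μ₀ • v) (n : ℕ) :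
    Y *ᵥ ((X ^ n) *ᵥ v) = (ω⁻¹ ^ n * μ₀) • ((X ^ n) *ᵥ v) := by
  have hYX : Y * X = ω⁻¹ • (X * Y) := by
    rw [hXY, smul_smul, inv_mul_cancel₀ hω0, one_smul]
  induction n with
  | zero => simp [hYv]
  | succ n ih =>
    rw [pow_succ', ← Matrix.mulVec_mulVec, Matrix.mulVec_mulVec, hYX, Matrix.smul_mulVec,
      ← Matrix.mulVec_mulVec, ih, Matrix.mulVec_smul, smul_smul, pow_succ]
    ring_nf

/-- **Schur-type rigidity of a clock–shift pair.**  If `X, Y ∈ GL_N(ℂ)` (`N ≥ 1`) satisfy `X Y = ω • Y X` with `ω` a primitive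
`N`-th root of unity, every matrix commuting with both `X` and `Y` is scalar. [cite: Thooft1979] -/
theorem exists_eq_smul_one_of_comm {N : ℕ} (hN : 1 ≤ N) {X Y K : Matrix (Fin N) (Fin N) ℂ}
    (hX : X.det ≠ 0) (hY : Y.det ≠ 0) {ω : ℂ} (hω : IsPrimitiveRoot ω N)
    (hXY : X * Y = ω • (Y * X)) (hKX : K * X = X * K) (hKY : K * Y = Y * K) :
    ∃ κ : ℂ, K = κ • (1 : Matrix (Fin N) (Fin N) ℂ) := by
  haveI : Nonempty (Fin N) := ⟨⟨0, hN⟩⟩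
  have hω0 : ω ≠ 0 := hω.ne_zero (by omega)
  -- an eigenvector of `Y`
  obtain ⟨μ₀, hμ₀⟩ := Module.End.exists_eigenvalue (Matrix.toLin' Y)
  obtain ⟨v, hv⟩ := hμ₀.exists_hasEigenvector
  have hYv : Y *ᵥ v = μ₀ • v := by
    have := hv.apply_eq_smul
    rwa [Matrix.toLin'_apply] at this
  have hv0 : v ≠ 0 := hv.right
  -- `μ₀ ≠ 0` (else `Y` is singular)
  have hμ00 : μ₀ ≠ 0 := by
    intro h
    rw [h, zero_smul] at hYv
    exact hY (Matrix.exists_mulVec_eq_zero_iff.mp ⟨v, hv0, hYv⟩)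
  -- the chain and its eigenvalues
  set w : Fin N → (Fin N → ℂ) := fun i => (X ^ (i : ℕ)) *ᵥ v with hw
  set μ : Fin N → ℂ := fun i => ω⁻¹ ^ (i : ℕ) * μ₀ with hμ
  have hYw : ∀ i, Y *ᵥ w i = μ i • w i := fun i => mulVec_chain hω0 hXY hYv i
  have hw0 : ∀ i, w i ≠ 0 := by
    intro i h
    have hdet : (X ^ (i : ℕ)).det = 0 := Matrix.exists_mulVec_eq_zero_iff.mp ⟨v, hv0, h⟩
    rw [Matrix.det_pow] at hdet
    exact hX (pow_eq_zero_iff'.mp hdet).1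
  have hμinj : Function.Injective μ := by
    intro i j hij
    simp only [hμ] at hij
    have h1 : ω⁻¹ ^ (i : ℕ) = ω⁻¹ ^ (j : ℕ) := mul_right_cancel₀ hμ00 hij
    exact Fin.ext (hω.inv.pow_inj i.isLt j.isLt h1)
  -- the chain is a basis of eigenvectors
  have hli : LinearIndependent ℂ w :=
    Module.End.eigenvectors_linearIndependent' (Matrix.toLin' Y) μ hμinj w fun i =>
      Module.End.hasEigenvector_iff.mpr
        ⟨Module.End.mem_eigenspace_iff.mpr (by rw [Matrix.toLin'_apply, hYw i]), hw0 i⟩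
  classical
  let b : Basis (Fin N) ℂ (Fin N → ℂ) := basisOfPiSpaceOfLinearIndependent hli
  have hb : ∀ i, b i = w i := fun i => congrFun (coe_basisOfPiSpaceOfLinearIndependent hli) i
  -- coordinates: `Y` acts diagonally
  have hdiag : ∀ (u : Fin N → ℂ) (j : Fin N), b.equivFun (Y *ᵥ u) j = μ j * b.equivFun u j := by
    intro u j
    have hu : u = ∑ i, b.equivFun u i • w i := by
      conv_lhs => rw [← b.sum_equivFun u]
      simp only [hb]
    have hYu : Y *ᵥ u = ∑ i, (b.equivFun u i * μ i) • w i := by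
      conv_lhs => rw [hu]
      rw [Matrix.mulVec_sum]
      refine Finset.sum_congr rfl fun i _ => ?_
      rw [Matrix.mulVec_smul, hYw i, smul_smul]
    have : Y *ᵥ u = b.equivFun.symm fun i => b.equivFun u i * μ i := by
      rw [hYu, Basis.equivFun_symm_apply]
      simp only [hb]
    rw [this, LinearEquiv.apply_symm_apply, mul_comm]
  -- `K w i` is a multiple of `w i`
  have hKdiag : ∀ i, K *ᵥ w i = b.equivFun (K *ᵥ w i) i • w i := by
    intro i
    set u := K *ᵥ w i with hu
    have hYu : Y *ᵥ u = μ i • u := by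
      rw [hu, Matrix.mulVec_mulVec, ← hKY, ← Matrix.mulVec_mulVec, hYw i, Matrix.mulVec_smul]
    have hcoef : ∀ j, j ≠ i → b.equivFun u j = 0 := by
      intro j hji
      have h1 := hdiag u j
      rw [hYu, map_smul, Pi.smul_apply, smul_eq_mul] at h1
      have h2 : (μ j - μ i) * b.equivFun u j = 0 := by linear_combination (-1 : ℂ) * h1
      rcases mul_eq_zero.mp h2 with h3 | h3
      · exact absurd (hμinj (sub_eq_zero.mp h3)) hji
      · exact h3
    calc u = ∑ j, b.equivFun u j • b j := (b.sum_equivFun u).symm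
      _ = b.equivFun u i • b i := Finset.sum_eq_single i (fun j _ hji => by rw [hcoef j hji, zero_smul])
          (fun h => absurd (Finset.mem_univ i) h)
      _ = b.equivFun u i • w i := by rw [hb]
  -- the diagonal is constant along the chain
  set κ : Fin N → ℂ := fun i => b.equivFun (K *ᵥ w i) i with hκ
  have hstep : ∀ (n : ℕ) (hn : n + 1 < N), κ ⟨n + 1, hn⟩ = κ ⟨n, by omega⟩ := by
    intro n hn
    have hwsucc : w ⟨n + 1, hn⟩ = X *ᵥ w ⟨n, by omega⟩ := by
      simp only [hw, pow_succ', Matrix.mulVec_mulVec]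
    have h1 : K *ᵥ w ⟨n + 1, hn⟩ = κ ⟨n, by omega⟩ • w ⟨n + 1, hn⟩ := by
      rw [hwsucc, Matrix.mulVec_mulVec, hKX, ← Matrix.mulVec_mulVec, hKdiag ⟨n, by omega⟩, Matrix.mulVec_smul]
    have h2 : K *ᵥ w ⟨n + 1, hn⟩ = κ ⟨n + 1, hn⟩ • w ⟨n + 1, hn⟩ := hKdiag ⟨n + 1, hn⟩
    exact smul_left_injective ℂ (hw0 ⟨n + 1, hn⟩) (h2.symm.trans h1)
  have hconst : ∀ i : Fin N, κ i = κ ⟨0, hN⟩ := by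
    intro i
    obtain ⟨n, hn⟩ := i
    induction n with
    | zero => rfl
    | succ n ih => rw [hstep n hn, ih (by omega)]
  -- hence `K = κ₀ • 1`
  refine ⟨κ ⟨0, hN⟩, ?_⟩
  have hlin : Matrix.toLin' K = Matrix.toLin' (κ ⟨0, hN⟩ • (1 : Matrix (Fin N) (Fin N) ℂ)) := by
    refine b.ext fun i => ?_
    rw [Matrix.toLin'_apply, Matrix.toLin'_apply, hb, hKdiag i, Matrix.smul_mulVec, Matrix.one_mulVec]
    exact congrArg (· • w i) (hconst i)
  exact Matrix.toLin'.injective hlin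

/-- **Item ⟨stmt-QuantumFields-24056⟩ `TwistExponentGap.PrimitiveCommutatorRigid`** (aside, 't Hooft's clock–shift rigidity): in
`SU(N)`, `N ≥ 2`, a pair whose group commutator is a primitive `N`-th root of unity times `1` has finite centraliser — every
element of it is `κ·1` with `κ^N = 1`. [cite: Thooft1979] -/
theorem primitiveCommutatorRigid_proof :
    Summit.QuantumFields.YangMills.Theses.TwistExponentGap.PrimitiveCommutatorRigid := by
  intro N hN x y hxy
  obtain ⟨ω, hω, hcomm⟩ := hxy
  have hN1 : 1 ≤ N := by omega
  -- `x y = ω • y x` as matrices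
  have hXY : (x : Matrix (Fin N) (Fin N) ℂ) * (y : Matrix (Fin N) (Fin N) ℂ) =
      ω • ((y : Matrix (Fin N) (Fin N) ℂ) * (x : Matrix (Fin N) (Fin N) ℂ)) := by
    have h1 : ((x * y * x⁻¹ * y⁻¹ : Matrix.specialUnitaryGroup (Fin N) ℂ) : Matrix (Fin N) (Fin N) ℂ) *
        ((y * x : Matrix.specialUnitaryGroup (Fin N) ℂ) : Matrix (Fin N) (Fin N) ℂ) =
        (x : Matrix (Fin N) (Fin N) ℂ) * (y : Matrix (Fin N) (Fin N) ℂ) := by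
      rw [← Submonoid.coe_mul, ← Submonoid.coe_mul]
      congr 1
      group
    rw [hcomm, Submonoid.coe_mul, smul_mul_assoc, one_mul] at h1
    exact h1.symm
  have hdet : ∀ k : Matrix.specialUnitaryGroup (Fin N) ℂ, (k : Matrix (Fin N) (Fin N) ℂ).det = 1 := fun k =>
    (Matrix.mem_specialUnitaryGroup_iff.mp k.2).2
  -- every element of the centraliser is `κ • 1` with `κ ^ N = 1`
  have key : ∀ k ∈ {k : Matrix.specialUnitaryGroup (Fin N) ℂ | k * x = x * k ∧ k * y = y * k},
      ∃ κ : ℂ, κ ^ N = 1 ∧ (k : Matrix (Fin N) (Fin N) ℂ) = κ • (1 : Matrix (Fin N) (Fin N) ℂ) := by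
    rintro k ⟨hkx, hky⟩
    have hkx' : (k : Matrix (Fin N) (Fin N) ℂ) * (x : Matrix (Fin N) (Fin N) ℂ) =
        (x : Matrix (Fin N) (Fin N) ℂ) * (k : Matrix (Fin N) (Fin N) ℂ) := by
      rw [← Submonoid.coe_mul, ← Submonoid.coe_mul, hkx]
    have hky' : (k : Matrix (Fin N) (Fin N) ℂ) * (y : Matrix (Fin N) (Fin N) ℂ) =
        (y : Matrix (Fin N) (Fin N) ℂ) * (k : Matrix (Fin N) (Fin N) ℂ) := by
      rw [← Submonoid.coe_mul, ← Submonoid.coe_mul, hky]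
    obtain ⟨κ, hκ⟩ := exists_eq_smul_one_of_comm hN1 (by rw [hdet x]; exact one_ne_zero)
      (by rw [hdet y]; exact one_ne_zero) hω hXY hkx' hky'
    refine ⟨κ, ?_, hκ⟩
    have h := hdet k
    rwa [hκ, Matrix.det_smul, Matrix.det_one, mul_one, Fintype.card_fin] at h
  -- inject the centraliser into the `N`-th roots of unity by the `(0,0)` entry
  refine Set.Finite.of_finite_image (f := fun k : Matrix.specialUnitaryGroup (Fin N) ℂ =>
    (k : Matrix (Fin N) (Fin N) ℂ) ⟨0, hN1⟩ ⟨0, hN1⟩) ?_ ?_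
  · refine Set.Finite.subset (s := {κ : ℂ | κ ^ N = 1}) ?_ ?_
    · have hroots : {κ : ℂ | κ ^ N = 1} = ↑(Polynomial.nthRoots N (1 : ℂ)).toFinset := by
        ext κ
        simp [Polynomial.mem_nthRoots (by omega : 0 < N)]
      rw [hroots]
      exact Finset.finite_toSet _
    · rintro _ ⟨k, hk, rfl⟩
      obtain ⟨κ, hκN, hκ⟩ := key k hk
      simp [hκ, hκN]
  · intro k hk k' hk' h
    obtain ⟨κ, -, hκ⟩ := key k hk
    obtain ⟨κ', -, hκ'⟩ := key k' hk'
    have hκκ : κ = κ' := by simpa [hκ, hκ'] using h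
    apply Subtype.ext
    rw [hκ, hκ', hκκ]

end Summit.QuantumFields.YangMills.Theorems.TwistExponentGap
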